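import Summits.BirchSwinnertonDyer.BirchSwinnertonDyer.Theorems.BiquadraticEisensteinDescentHeegnerTwistCouplingInSupplyLinnikCensusGeneral
import Mathlib.Data.Nat.Choose.Bounds
import HarnessLib

set_option linter.dupNamespace false -- `Summit.BirchSwinnertonDyer.BirchSwinnertonDyer.Theorems.…` (summit = sub)
set_option autoImplicit false

/-!
# Crux `HeegnerTwistCouplingInSupply` (stmt-BirchSwinnertonDyer-21381) — Linnik census of a SINGLE SLOT:
# «no prime `q ≤ Q^{1/4}` in the unit class `c (mod M)` with `(q/p) = s`» is `O_{M}(log⁸ Q)`-sparse in `p`, either sign `s`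

Route `BiquadraticEisensteinDescent` (cell `pub/bsd-wall`, width seat `bsd-wall-cm-bed-w3` g19; `--supports` 21381, helper).
Engine file for the k = 1 PATTERN-FREE CENSUS of the two-parameter congruent families `E_{pr}`, `E_{2pr}` (companion
`…LinnikCensusKOne.lean`): a pattern-free winning family of the sign-table game (w3 g18's `SymbolicMonsky` engine) needs, for each of
its `t ≤ 3` slots, ONE prime `q ≤ Q^{1/4}` in a fixed unit class `c (mod 8r)` with a prescribed Legendre sign `(q/p) = s`. This file
bounds the primes `p` for which a slot FAILS:

* `card_le_of_residue_amplifier` — the sign-`+1` twin of `…LinnikCensusGeneral.card_le_of_nonresidue_amplifier`: if every located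
  prime is a RESIDUE modulo every `p ∈ P`, the products of `k` of them are residues too (any `k`), and Montgomery's arithmetic large sieve
  (tree, PROVED: `Literature.NumberTheory.Sieve.ArithmeticLargeSieve.card_primes_le_of_forbidden_classes`) gives `#P ≤ 4Q²/C(#L,k)`;
* `exists_card_primesMod_ge_slack` — located-class supply at height `y` with slack: `y/(8φ(M) log y) + 7 ≤ #{q ≤ y prime, q ≡ c (M)}`
  for large `y` (tree PNT for progressions, PROVED, through `exists_card_primesMod_mul_log_ge`);
* ★ `slotCensus` — for every modulus `M ≥ 1`, unit class `c`, and sign `s ∈ {1, −1}`: `∃ C > 0, ∀ Q ≥ 3`,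
  `#{p ≤ Q prime, ⌊√Q⌋ < p : no prime q ≤ ⌊⌊√Q⌋^{1/2}⌋, q ≡ c (M), (q/p) = s} ≤ C (log Q)⁸` — amplifier of EIGHT located primes
  (`(Q^{1/4})⁸ ≤ Q²`), no named fact.

HONEST FRAMING: an unconditional analytic-number-theory engine; by itself it proves nothing about any curve; the crux (C⁺), its stubs and
BSD are untouched. THEOREMS ONLY (no `def`); constants not optimised.
-/

namespace Summit.BirchSwinnertonDyer.BirchSwinnertonDyer.Theorems.LinnikCensus

open Finset
open Literature.NumberTheory.Sieve.ArithmeticLargeSieve (intRes intRes_natCast card_primes_le_of_forbidden_classes)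

/-! ## The residue-sign amplifier -/

/-- If every member of a finset of naturals is a quadratic RESIDUE mod `b` (symbol `+1`), so is the product. [folklore] -/
theorem jacobiSym_finsetProd_of_forall_eq_one {b : ℕ} (s : Finset ℕ) (h : ∀ q ∈ s, jacobiSym (q : ℤ) b = 1) :
    jacobiSym ((∏ q ∈ s, q : ℕ) : ℤ) b = 1 := by
  induction s using Finset.cons_induction with
  | empty => simp [jacobiSym.one_left]
  | cons a s ha ih =>
      rw [Finset.prod_cons, Nat.cast_mul, jacobiSym.mul_left, h a (Finset.mem_cons_self a s),
        ih (fun q hq => h q (Finset.mem_cons.mpr (Or.inr hq))), one_mul]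

/-- ★ **The amplifier sieve, residue version.** `P` a finite set of odd primes `≤ Q`, `L` a finite set of primes `≤ y`, `y^k ≤ Q²`,
`C(#L,k) ≥ 1`, and every `q ∈ L` a quadratic residue modulo every `p ∈ P`: then `#P ≤ 4Q²/C(#L,k)` (products of `k` distinct
primes of `L` are non-zero residues mod each `p ∈ P`, hence avoid the `≥ p/2` classes `{h : (h/p) ≠ 1}`; Montgomery with `τ = 1/2`).
[cite: Montgomery1978, p. 561] -/
theorem card_le_of_residue_amplifier {Q y k : ℕ} (hQ : 1 ≤ Q) (hyk : y ^ k ≤ Q ^ 2)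
    (P L : Finset ℕ) (hP : ∀ p ∈ P, p.Prime ∧ p ≠ 2 ∧ p ≤ Q) (hL : ∀ q ∈ L, q.Prime ∧ q ≤ y)
    (hPL : ∀ p ∈ P, ∀ q ∈ L, jacobiSym (q : ℤ) p = 1) (hA : 1 ≤ L.card.choose k) :
    (P.card : ℝ) ≤ 4 * (Q : ℝ) ^ 2 / (L.card.choose k : ℕ) := by
  classical
  set A := (L.powersetCard k).image (fun s => ∏ q ∈ s, q) with hAdef
  set N : Finset ℤ := A.map Nat.castEmbedding with hNdef
  have hAcard : A.card = L.card.choose k := by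
    rw [hAdef, Finset.card_image_of_injOn, Finset.card_powersetCard]
    intro s hs t ht hst
    have hs' : ∀ q ∈ s, q.Prime := fun q hq => (hL q ((Finset.mem_powersetCard.mp (Finset.mem_coe.mp hs)).1 hq)).1
    have ht' : ∀ q ∈ t, q.Prime := fun q hq => (hL q ((Finset.mem_powersetCard.mp (Finset.mem_coe.mp ht)).1 hq)).1
    have hst' : ∏ q ∈ s, q = ∏ q ∈ t, q := hst
    calc s = (∏ q ∈ s, q).primeFactors := (Nat.primeFactors_prod hs').symm
      _ = (∏ q ∈ t, q).primeFactors := by rw [hst']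
      _ = t := Nat.primeFactors_prod ht'
  have hNcard : N.card = A.card := Finset.card_map _
  let J : ℕ → Finset ℕ := fun p =>
    if p ∈ P then (Finset.range p).filter (fun h : ℕ => jacobiSym (h : ℤ) p ≠ 1) else ∅
  have hNsub : N ⊆ Finset.Ioc (0 : ℤ) (0 + ((Q ^ 2 : ℕ) : ℕ)) := by
    intro n hn
    rw [hNdef, Finset.mem_map] at hn
    obtain ⟨m, hm, rfl⟩ := hn
    obtain ⟨s, hs, rfl⟩ := Finset.mem_image.mp hm
    obtain ⟨hsL, hcard⟩ := Finset.mem_powersetCard.mp hs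
    have hm0 : 0 < ∏ q ∈ s, q := Finset.prod_pos fun q hq => (hL q (hsL hq)).1.pos
    have hmle : ∏ q ∈ s, q ≤ Q ^ 2 := by
      calc ∏ q ∈ s, q ≤ y ^ s.card := Finset.prod_le_pow_card s (fun q => q) y fun q hq => (hL q (hsL hq)).2
        _ = y ^ k := by rw [hcard]
        _ ≤ Q ^ 2 := hyk
    simp only [Nat.castEmbedding_apply, Finset.mem_Ioc, zero_add]
    exact ⟨by exact_mod_cast hm0, by exact_mod_cast hmle⟩
  have hJ : ∀ p, p.Prime → p ≤ Q → J p ⊆ Finset.range p ∧ (J p).card < p := by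
    intro p hp _
    by_cases hpP : p ∈ P
    · simp only [J, if_pos hpP]
      exact ⟨Finset.filter_subset _ _, card_nonResidueClasses_lt hp⟩
    · simp only [J, if_neg hpP]
      exact ⟨Finset.empty_subset _, by simp [hp.pos]⟩
  have hav : ∀ p, p.Prime → p ≤ Q → ∀ n ∈ N, intRes p n ∉ J p := by
    intro p hp _ n hn
    rw [hNdef, Finset.mem_map] at hn
    obtain ⟨m, hm, rfl⟩ := hn
    rw [Nat.castEmbedding_apply, intRes_natCast]
    by_cases hpP : p ∈ P
    · simp only [J, if_pos hpP]
      obtain ⟨s, hs, rfl⟩ := Finset.mem_image.mp hm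
      obtain ⟨hsL, -⟩ := Finset.mem_powersetCard.mp hs
      exact natMod_not_mem_nonResidueClasses
        (jacobiSym_finsetProd_of_forall_eq_one s (fun q hq => hPL p hpP q (hsL hq)))
    · simp only [J, if_neg hpP]
      simp
  have hτJ : ∀ p ∈ P, (1 / 2 : ℝ) * p ≤ ((J p).card : ℝ) := by
    intro p hp
    obtain ⟨hpp, hp2, -⟩ := hP p hp
    simp only [J, if_pos hp]
    have := natCast_le_two_mul_card_nonResidueClasses hpp hp2
    linarith
  have hZ : 1 ≤ N.card := by rw [hNcard, hAcard]; exact hA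
  have hmain := card_primes_le_of_forbidden_classes N 0 (Q ^ 2) Q hQ J hNsub hJ hav P
    (fun p hp => ⟨(hP p hp).1, (hP p hp).2.2⟩) (τ := 1 / 2) (by norm_num) hτJ hZ
  rw [hNcard, hAcard] at hmain
  have hApos : (0 : ℝ) < (L.card.choose k : ℕ) := by exact_mod_cast hA
  refine hmain.trans ?_
  rw [div_le_div_iff₀ (by positivity) hApos]
  push_cast
  nlinarith [hApos]

/-- **Both signs at once**: if every `q ∈ L` has the SAME sign `(q/p) = s` modulo every `p ∈ P` (`s = 1` or `s = −1`), with
`k` even, `y^k ≤ Q²`, `C(#L,k) ≥ 1`: `#P ≤ 4Q²/C(#L,k)`. [cite: Montgomery1978, p. 561] -/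
theorem card_le_of_constSign_amplifier {Q y k : ℕ} (hQ : 1 ≤ Q) (hyk : y ^ k ≤ Q ^ 2) (hk : Even k)
    (P L : Finset ℕ) (hP : ∀ p ∈ P, p.Prime ∧ p ≠ 2 ∧ p ≤ Q) (hL : ∀ q ∈ L, q.Prime ∧ q ≤ y)
    {s : ℤ} (hs : s = 1 ∨ s = -1) (hPL : ∀ p ∈ P, ∀ q ∈ L, jacobiSym (q : ℤ) p = s)
    (hA : 1 ≤ L.card.choose k) :
    (P.card : ℝ) ≤ 4 * (Q : ℝ) ^ 2 / (L.card.choose k : ℕ) := by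
  rcases hs with rfl | rfl
  · exact card_le_of_residue_amplifier hQ hyk P L hP hL hPL hA
  · exact card_le_of_nonresidue_amplifier hQ hyk hk P L hP hL hPL hA

/-! ## Supply with slack, at a general modulus -/

/-- **Located-class supply with slack**: for a unit class `c (mod M)`, for all large `y`,
`y/(8 φ(M) log y) + 7 ≤ #{q ≤ y prime : q ≡ c (mod M)}` (PNT lower bound `y/(2φ(M) log y)` minus slack, absorbed by
`56 φ(M) · log y ≤ y`… via `exists_const_mul_log_le`). [cite: MontgomeryVaughan2007, Cor. 11.17] -/
theorem exists_card_primesMod_ge_slack (M c : ℕ) [NeZero M] (hc : IsUnit ((c : ℕ) : ZMod M)) :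
    ∃ y₀ : ℕ, 2 ≤ y₀ ∧ ∀ y : ℕ, y₀ ≤ y →
      (y : ℝ) / (8 * M.totient * Real.log y) + 7 ≤
        (((Finset.Icc 1 y).filter (fun q : ℕ => q.Prime ∧ q % M = c % M)).card : ℝ) := by
  obtain ⟨X₀, hX₀⟩ := exists_card_primesMod_mul_log_ge M c hc
  have hφ : (0 : ℝ) < M.totient := by exact_mod_cast Nat.totient_pos.mpr (NeZero.pos M)
  obtain ⟨y₁, hy₁⟩ := exists_const_mul_log_le (56 * M.totient)
  refine ⟨max (max X₀ y₁) 2, le_max_right _ _, fun y hy => ?_⟩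
  have hyX : X₀ ≤ y := le_trans (le_trans (le_max_left _ _) (le_max_left _ _)) hy
  have hyy : y₁ ≤ y := le_trans (le_trans (le_max_right _ _) (le_max_left _ _)) hy
  have hy2 : (2 : ℝ) ≤ y := by exact_mod_cast le_trans (le_max_right _ _) hy
  have hlog : 0 < Real.log y := Real.log_pos (by linarith)
  have h1 := hX₀ y hyX
  have h2 := hy₁ y hyy
  set k : ℝ := (((Finset.Icc 1 y).filter (fun q : ℕ => q.Prime ∧ q % M = c % M)).card : ℝ) with hk
  have hk0 : 0 ≤ k := Nat.cast_nonneg _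
  -- `y/(2φ log y) ≤ k` and `56 φ log y ≤ y` ⇒ `y/(8φ log y) + 7 ≤ k`
  have h1' : (y : ℝ) ≤ k * Real.log y * (2 * M.totient) := by
    rw [div_le_iff₀ (by positivity)] at h1; linarith
  rw [div_add' _ _ _ (by positivity), div_le_iff₀ (by positivity)]
  nlinarith [h1', h2, hlog, hφ, mul_pos hlog hφ]

/-! ## The slot census -/

open scoped Classical in
/-- ★ **`slotCensus` — a single located slot fails only on `O(log⁸ Q)` primes.** For every modulus `M ≥ 1`, unit class `c (mod M)`
and sign `s ∈ {1, −1}` there is `C > 0` such that for every `Q ≥ 3` the number of primes `p ≤ Q` with `⌊√Q⌋ < p` for which NO prime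
`q ≤ ⌊⌊√Q⌋^{1/2}⌋` with `q ≡ c (mod M)` has `(q/p) = s` is at most `C · (log Q)⁸`. Proof: on such a `p` every located prime `q` has the
constant sign `(q/p) = −s` (`q ≠ p` as `q < p`, so the symbol is `±1`); `card_le_of_constSign_amplifier` with `k = 8`,
`y = ⌊⌊√Q⌋^{1/2}⌋` (`y⁸ ≤ Q²`, `Q² ≤ 256 y⁸`), supply `exists_card_primesMod_ge_slack`, arithmetic `census_arith8`-style; below the
threshold the trivial bound. [cite: Montgomery1978, p. 561] [cite: MontgomeryVaughan2007, Cor. 11.17] -/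
theorem slotCensus (M c : ℕ) [NeZero M] (hc : IsUnit ((c : ℕ) : ZMod M)) {s : ℤ} (hs : s = 1 ∨ s = -1) :
    ∃ C : ℝ, 0 < C ∧ ∀ Q : ℕ, 3 ≤ Q →
      ((((Finset.range (Q + 1)).filter (fun p : ℕ => p.Prime ∧ Nat.sqrt Q < p ∧
          ∀ q : ℕ, q.Prime → q % M = c % M → q ≤ Nat.sqrt (Nat.sqrt Q) → jacobiSym (q : ℤ) p ≠ s)).card : ℝ))
        ≤ C * Real.log Q ^ 8 := by
  obtain ⟨y₀, hy₀2, hy₀⟩ := exists_card_primesMod_ge_slack M c hc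
  obtain ⟨y₁, hy₁⟩ := exists_const_mul_log_le (8 * M.totient)
  have hφ : (0 : ℝ) < M.totient := by exact_mod_cast Nat.totient_pos.mpr (NeZero.pos M)
  set Q₀ : ℕ := ((max y₀ y₁) ^ 2) ^ 2 with hQ₀
  set C₀ : ℝ := 4 * 256 * 40320 * (8 * M.totient) ^ 8 with hC₀
  have hC₀0 : 0 < C₀ := by rw [hC₀]; positivity
  refine ⟨max C₀ ((Q₀ : ℝ) + 1), lt_max_of_lt_left hC₀0, fun Q hQ3 => ?_⟩
  have hlog3 : 1 ≤ Real.log Q := by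
    have hQ3' : (3 : ℝ) ≤ Q := by exact_mod_cast hQ3
    have he : Real.exp 1 ≤ (Q : ℝ) := le_trans (le_of_lt (lt_trans Real.exp_one_lt_d9 (by norm_num))) hQ3'
    rwa [← Real.log_le_log_iff (Real.exp_pos 1) (by linarith), Real.log_exp] at he
  have hlog8 : 1 ≤ Real.log Q ^ 8 := one_le_pow₀ hlog3
  by_cases hQ : Q₀ ≤ Q
  · set y := Nat.sqrt (Nat.sqrt Q) with hydef
    have hyge : max y₀ y₁ ≤ y := by
      rw [hydef, Nat.le_sqrt', Nat.le_sqrt']; exact hQ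
    have hyy₀ : y₀ ≤ y := le_trans (le_max_left _ _) hyge
    have hyy₁ : y₁ ≤ y := le_trans (le_max_right _ _) hyge
    have hy2 : 2 ≤ y := le_trans hy₀2 hyy₀
    have hy2' : (2 : ℝ) ≤ y := by exact_mod_cast hy2
    have hlogy : 0 < Real.log y := Real.log_pos (by linarith)
    have hk := hy₀ y hyy₀
    have h8φ := hy₁ y hyy₁
    -- `t := y / (8 φ log y) ≥ 1`
    have ht : 1 ≤ (y : ℝ) / (8 * M.totient * Real.log y) := by
      rw [le_div_iff₀ (by positivity)]; linarith
    set L := (Finset.Icc 1 y).filter (fun q : ℕ => q.Prime ∧ q % M = c % M) with hLdef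
    have hk8 : 1 ≤ L.card.choose 8 := by
      have h8 : (8 : ℝ) ≤ (L.card : ℝ) := by linarith
      have h8' : 8 ≤ L.card := by exact_mod_cast h8
      exact Nat.choose_pos h8'
    -- `y⁸ ≤ Q²`, `Q² ≤ 256 y⁸`
    have hysq : y ^ 2 ≤ Nat.sqrt Q := Nat.sqrt_le' _
    have hsq : Nat.sqrt Q ^ 2 ≤ Q := Nat.sqrt_le' _
    have hy8 : y ^ 8 ≤ Q ^ 2 := by
      calc y ^ 8 = ((y ^ 2) ^ 2) ^ 2 := by ring
        _ ≤ (Nat.sqrt Q ^ 2) ^ 2 := by gcongr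
        _ ≤ Q ^ 2 := by gcongr
    have hQy : (Q : ℝ) ^ 2 ≤ 256 * (y : ℝ) ^ 8 := by
      have h3 : Q < (Nat.sqrt Q + 1) ^ 2 := Nat.lt_succ_sqrt' Q
      have h4 : Nat.sqrt Q < (y + 1) ^ 2 := Nat.lt_succ_sqrt' _
      have h9 : Q ≤ (2 * y) ^ 4 := by
        have h5 : Nat.sqrt Q + 1 ≤ (y + 1) ^ 2 := h4
        calc Q ≤ (Nat.sqrt Q + 1) ^ 2 := h3.le
          _ ≤ ((y + 1) ^ 2) ^ 2 := Nat.pow_le_pow_left h5 2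
          _ = (y + 1) ^ 4 := by ring
          _ ≤ (2 * y) ^ 4 := Nat.pow_le_pow_left (by omega) 4
      have h10 : (Q : ℝ) ≤ ((2 * y : ℕ) : ℝ) ^ 4 := by exact_mod_cast h9
      calc (Q : ℝ) ^ 2 ≤ (((2 * y : ℕ) : ℝ) ^ 4) ^ 2 := by gcongr
        _ = 256 * (y : ℝ) ^ 8 := by push_cast; ring
    have hyle : y ≤ Nat.sqrt Q := Nat.sqrt_le_self _
    set P := (Finset.range (Q + 1)).filter (fun p : ℕ => p.Prime ∧ Nat.sqrt Q < p ∧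
          ∀ q : ℕ, q.Prime → q % M = c % M → q ≤ Nat.sqrt (Nat.sqrt Q) → jacobiSym (q : ℤ) p ≠ s) with hPdef
    have hP : ∀ p ∈ P, p.Prime ∧ p ≠ 2 ∧ p ≤ Q := by
      intro p hp
      rw [hPdef, Finset.mem_filter, Finset.mem_range] at hp
      obtain ⟨hpQ, hpp, hyp, -⟩ := hp
      refine ⟨hpp, ?_, by omega⟩
      have : y ^ 2 ≤ Nat.sqrt Q := hysq
      rintro rfl
      nlinarith
    have hL : ∀ q ∈ L, q.Prime ∧ q ≤ y := by
      intro q hq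
      rw [hLdef, Finset.mem_filter, Finset.mem_Icc] at hq
      exact ⟨hq.2.1, hq.1.2⟩
    have hPL : ∀ p ∈ P, ∀ q ∈ L, jacobiSym (q : ℤ) p = -s := by
      intro p hp q hq
      rw [hPdef, Finset.mem_filter, Finset.mem_range] at hp
      obtain ⟨-, hpp, hyp, hno⟩ := hp
      rw [hLdef, Finset.mem_filter, Finset.mem_Icc] at hq
      obtain ⟨⟨-, hqy⟩, hqp, hqc⟩ := hq
      have hne : q ≠ p := by
        intro h; subst h
        have := hyle; omega
      have hcop : Int.gcd (q : ℤ) p = 1 := by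
        rw [Int.gcd_natCast_natCast]
        exact (Nat.coprime_primes hqp hpp).mpr hne
      have hns := hno q hqp hqc hqy
      rcases jacobiSym.eq_one_or_neg_one hcop with h | h <;> rcases hs with rfl | rfl
      · exact absurd h hns
      · rw [h]; norm_num
      · rw [h]
      · exact absurd h hns
    have hs' : -s = 1 ∨ -s = -1 := by rcases hs with rfl | rfl <;> norm_num
    have hE := card_le_of_constSign_amplifier (by omega) hy8 (by decide) P L hP hL hs' hPL hk8
    -- arithmetic: `C(k,8) ≥ t⁸/8!`, `t = y/(8φ log y)`
    set t : ℝ := (y : ℝ) / (8 * M.totient * Real.log y) with htdef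
    have hk7 : 7 ≤ L.card := by
      have : (7 : ℝ) ≤ L.card := by linarith
      exact_mod_cast this
    have hchoose : ((L.card - 7 : ℕ) : ℝ) ^ 8 / 40320 ≤ (L.card.choose 8 : ℕ) := by
      have h := Nat.pow_le_choose (α := ℝ) 8 L.card
      have h87 : L.card + 1 - 8 = L.card - 7 := by omega
      rw [h87, show (Nat.factorial 8 : ℝ) = 40320 by norm_num [Nat.factorial]] at h
      exact_mod_cast h
    have hkt : t ≤ ((L.card - 7 : ℕ) : ℝ) := by
      rw [Nat.cast_sub hk7]; push_cast; linarith
    have ht0 : 0 ≤ t := le_trans zero_le_one ht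
    have ht8 : t ^ 8 / 40320 ≤ (L.card.choose 8 : ℕ) := le_trans (by gcongr) hchoose
    have htpos : 0 < t ^ 8 / 40320 := by positivity
    have hty : t * (8 * M.totient * Real.log y) = y := by
      rw [htdef]; field_simp
    have hmain : (P.card : ℝ) ≤ C₀ * Real.log y ^ 8 := by
      calc (P.card : ℝ) ≤ 4 * (Q : ℝ) ^ 2 / (L.card.choose 8 : ℕ) := hE
        _ ≤ 4 * (Q : ℝ) ^ 2 / (t ^ 8 / 40320) := by gcongr
        _ ≤ 4 * (256 * (y : ℝ) ^ 8) / (t ^ 8 / 40320) := by gcongr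
        _ = 4 * 256 * 40320 * (y : ℝ) ^ 8 / t ^ 8 := by field_simp
        _ = 4 * 256 * 40320 * (t * (8 * M.totient * Real.log y)) ^ 8 / t ^ 8 := by rw [hty]
        _ = C₀ * Real.log y ^ 8 := by
            have ht' : t ^ 8 ≠ 0 := by positivity
            rw [hC₀, mul_pow, mul_comm (t ^ 8) _, ← mul_assoc, mul_div_assoc, div_self ht', mul_one]
            ring
    have hlogyQ : Real.log y ≤ Real.log Q := by
      apply Real.log_le_log (by linarith)
      exact_mod_cast (hyle.trans (Nat.sqrt_le_self Q))
    calc (P.card : ℝ) ≤ C₀ * Real.log y ^ 8 := hmain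
      _ ≤ C₀ * Real.log Q ^ 8 :=
          mul_le_mul_of_nonneg_left (pow_le_pow_left₀ hlogy.le hlogyQ 8) hC₀0.le
      _ ≤ max C₀ ((Q₀ : ℝ) + 1) * Real.log Q ^ 8 :=
          mul_le_mul_of_nonneg_right (le_max_left _ _) (by positivity)
  · have hQ' : Q < Q₀ := not_le.mp hQ
    have hcard : (((Finset.range (Q + 1)).filter (fun p : ℕ => p.Prime ∧ Nat.sqrt Q < p ∧
        ∀ q : ℕ, q.Prime → q % M = c % M → q ≤ Nat.sqrt (Nat.sqrt Q) → jacobiSym (q : ℤ) p ≠ s)).card : ℝ)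
          ≤ (Q₀ : ℝ) + 1 := by
      have h1 := Finset.card_filter_le (Finset.range (Q + 1)) (fun p : ℕ => p.Prime ∧ Nat.sqrt Q < p ∧
        ∀ q : ℕ, q.Prime → q % M = c % M → q ≤ Nat.sqrt (Nat.sqrt Q) → jacobiSym (q : ℤ) p ≠ s)
      rw [Finset.card_range] at h1
      have : (Q : ℝ) + 1 ≤ (Q₀ : ℝ) + 1 := by
        have := hQ'.le; exact_mod_cast Nat.succ_le_succ this
      calc _ ≤ ((Q + 1 : ℕ) : ℝ) := by exact_mod_cast h1
        _ = (Q : ℝ) + 1 := by push_cast; ring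
        _ ≤ (Q₀ : ℝ) + 1 := this
    calc _ ≤ (Q₀ : ℝ) + 1 := hcard
      _ ≤ max C₀ ((Q₀ : ℝ) + 1) := le_max_right _ _
      _ = max C₀ ((Q₀ : ℝ) + 1) * 1 := (mul_one _).symm
      _ ≤ max C₀ ((Q₀ : ℝ) + 1) * Real.log Q ^ 8 :=
          mul_le_mul_of_nonneg_left hlog8 (le_trans (by positivity) (le_max_right _ _))

/-! ## Slot classes exist for every odd prime (appended) -/

/-- **Slot classes exist for every odd prime `r`**: for an odd residue `a (mod 8)` and a prescribed sign `e`, there is a unit class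
`k (mod 8r)` with `k ≡ a (mod 8)` such that every prime `q ≡ k (mod 8r)` has `[(q/r) = −1] = e` (CRT with a residue / non-residue mod `r`).
[folklore] -/
theorem exists_slotClass {r : ℕ} (hr : r.Prime) (hr2 : r ≠ 2) {a : ℕ} (ha : a % 2 = 1) (e : Bool) :
    ∃ k : ℕ, IsUnit ((k : ℕ) : ZMod (8 * r)) ∧ k % 8 = a % 8 ∧
      ∀ q : ℕ, q.Prime → q % (8 * r) = k % (8 * r) → (jacobiSym (q : ℤ) r = -1 ↔ e = true) := by
  haveI : Fact r.Prime := ⟨hr⟩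
  -- a residue `x` mod `r` with the prescribed symbol and `r ∤ x`
  obtain ⟨x, hx0, hxe⟩ : ∃ x : ℕ, x % r ≠ 0 ∧ (jacobiSym (x : ℤ) r = -1 ↔ e = true) := by
    cases e with
    | false =>
      refine ⟨1, ?_, ?_⟩
      · rw [Nat.one_mod_eq_one.mpr hr.one_lt.ne']; exact one_ne_zero
      · simp [jacobiSym.one_left]
    | true =>
      have hch : ringChar (ZMod r) ≠ 2 := by rwa [ZMod.ringChar_zmod_n]
      obtain ⟨b, hb⟩ := FiniteField.exists_nonsquare hch
      refine ⟨b.val, ?_, ?_⟩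
      · intro h0
        have hlt : b.val < r := ZMod.val_lt b
        have hv : b.val = 0 := by rw [Nat.mod_eq_of_lt hlt] at h0; exact h0
        have hb0 : b = 0 := (ZMod.val_eq_zero b).mp hv
        exact hb (hb0 ▸ IsSquare.zero)
      · simp only [iff_true]
        rw [← jacobiSym.legendreSym.to_jacobiSym, legendreSym.eq_neg_one_iff]
        simpa using hb
  -- CRT
  have hco : Nat.Coprime 8 r := by
    have h2r : Nat.Coprime 2 r := (Nat.coprime_primes Nat.prime_two hr).mpr (Ne.symm hr2)
    have : Nat.Coprime (2 ^ 3) r := Nat.Coprime.pow_left 3 h2r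
    simpa using this
  obtain ⟨k, hk8, hkr⟩ := Nat.chineseRemainder hco (a % 8) x
  refine ⟨k, ?_, ?_, ?_⟩
  · rw [ZMod.isUnit_iff_coprime]
    apply Nat.Coprime.mul_right
    · -- coprime to 8: `k ≡ a (mod 8)` odd
      have hk2 : k % 2 = 1 := by
        have h1 : k % 8 = a % 8 := by simpa [Nat.ModEq, Nat.mod_mod] using hk8
        omega
      have : Nat.Coprime k 2 := by
        rw [Nat.coprime_comm, Nat.Prime.coprime_iff_not_dvd Nat.prime_two]; omega
      simpa using this.pow_right 3
    · -- coprime to r: `k ≡ x (mod r)`, `r ∤ x`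
      rw [Nat.coprime_comm, Nat.Prime.coprime_iff_not_dvd hr]
      intro hdvd
      apply hx0
      have h1 : k % r = 0 := Nat.mod_eq_zero_of_dvd hdvd
      have h2 : k % r = x % r := hkr
      omega
  · simpa [Nat.ModEq, Nat.mod_mod] using hk8
  · intro q _ hqk
    have hqr : q % r = x % r := by
      have h1 : q % r = k % r := by
        rw [← Nat.mod_mod_of_dvd q (dvd_mul_left r 8), hqk, Nat.mod_mod_of_dvd k (dvd_mul_left r 8)]
      rw [h1]; exact hkr
    have hJ : jacobiSym (q : ℤ) r = jacobiSym (x : ℤ) r := by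
      rw [jacobiSym.mod_left (q : ℤ) r, jacobiSym.mod_left (x : ℤ) r]
      congr 1
      omega
    rw [hJ]; exact hxe

end Summit.BirchSwinnertonDyer.BirchSwinnertonDyer.Theorems.LinnikCensus
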